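import Literature.Topology.FourManifolds.CappellShanesonClassNumberTwo
import Mathlib.NumberTheory.NumberField.Units.DirichletTheorem
import HarnessLib

/-!
# The cubic field of discriminant `2777` has class number two: `𝔭₅ = (5, θ - 2)` is not principal

Third file of the discharge of `aitchisonRubinstein1984_traceNegFiveClasses` (Gompf, Algebr.
Geom. Topol. 10 (2010), Examples 3.1(b); Aitchison–Rubinstein, Contemp. Math. 35 (1984),
Appendix, Table 1, row `a = -5`: `Δ(f₋₅) = 2777`, `|C(R')| = 2`). The previous file showed that
every ideal class of a cubic field `K` generated by a root `θ` of `f₋₅ = x³ + 5x² - 6x - 1` is `1`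
or `[𝔭₅]`, `𝔭₅ = (5, θ - 2)`, with `𝔭₅² = (2θ + 1)`. Here: **`𝔭₅` is not principal**
(`not_isPrincipal_P5_negFive`), hence the class number is exactly `2` (`classNumber_eq_two_negFive`).

## The proof (units modulo squares; Dirichlet's unit theorem and residue symbols)

The table entry `|C(R')| = 2` is quoted by Aitchison–Rubinstein from tables; we give a proof.
If `𝔭₅ = (α)` then `(α²) = 𝔭₅² = (2θ + 1)`, so `α² u = 2θ + 1` for a unit `u`. The obstruction is
that no `r (2θ + 1)`, `r` a unit, is a square — which needs control of ALL units modulo squares: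

* `θ` and `θ - 1` are units (`θ (θ² + 5θ - 6) = 1`, `(θ - 1)(θ² + 6θ) = 1`: `N(θ) = 1`,
  `N(θ - 1) = -f₋₅(1) = 1`, the Cappell–Shaneson conditions `det A = det (A - I) = 1`).
* Residue maps `ψ_q : 𝓞 K = ℤ[θ] → 𝔽_q`, `θ ↦ c`, at the degree-one primes `(3, θ - 2)`,
  `(5, θ - 2)`, `(7, θ - 4)`, `(13, θ - 9)`, `(17, θ - 4)` (`exists_ringHom_zmod_negFive`, through
  `ℤ[X]/(f₋₅) ≅ 𝓞 K`), and the "signature" `σ(x) = (ψ₃(x), ψ₅(x)², ψ₇(x)³) ∈ {±1}³` of a unit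
  (Euler's criterion exponents `(q-1)/2 = 1, 2, 3`): multiplicative, trivial on squares, and
  `σ(-1) = (-,+,-)`, `σ(θ) = (-,-,+)`, `σ(θ - 1) = (+,+,-)` generate `{±1}³`.
* Dirichlet's unit theorem (Mathlib's `NumberField.Units.exist_unique_eq_mul_prod`): every unit
  is `±∏ εᵢ^{eᵢ}` over a fundamental system of `rank K = r₁ + r₂ - 1 ≤ 2` units (`r₁ + 2r₂ = 3`;
  torsion `= {±1}` in odd degree), hence is `ρ(e) η²` for one of the AT MOST `8` elements
  `ρ(e) = ±∏ εᵢ^{0 or 1}`. As `σ ∘ ρ` hits all `8` signatures it is injective, so a unit of trivial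
  signature is a square (`isSquare_of_signature_eq_one_negFive`): `(𝓞 K)ˣ/((𝓞 K)ˣ)² ≅ {±1}³`
  via `σ`, with representatives `±θ^i (θ-1)^j`.
* Hence `α² u = 2θ + 1` gives `u = r η²` with `r ∈ {±θ^i(θ-1)^j}` of the same signature as `u`,
  and `(α η)² r = 2θ + 1`; each of the eight cases is refuted in some `𝔽_q`, `q ∈ {3, 7, 13, 17}`,
  where `(2c + 1)/r(c)` is a non-residue (`not_isPrincipal_P5_negFive`).

## References

* [AitchisonRubinstein1984] I. R. Aitchison, J. H. Rubinstein, Contemp. Math. 35 (1984), Appendix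
  "Conjugacy in `SL(3, ℤ)`", Table 1 (row `a = -5`: `|C(R')| = 2`) and Example `a = -5`.
* [GompfAGT2010] R. E. Gompf, Algebr. Geom. Topol. 10 (2010), Examples 3.1(b).
* [Marcus2018] D. A. Marcus, *Number Fields*, 2nd ed., Ch. 5 (Dirichlet's unit theorem, Thm. 38,
  and the class-number computations after Thm. 37).
-/

noncomputable section

open Set Polynomial Module NumberField Ideal
open scoped NumberField

namespace Literature.Topology.FourManifolds

section Root

variable {K : Type*} [Field K] [NumberField K] {a : ℤ} {θ : K}

/-! ### `ℤ[X]/(f_a) ≅ 𝓞 K` and the residue maps at degree-one primes -/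

/-- **`ℤ[X]/(f_a) ≅ 𝓞 K = ℤ[θ]`** under the square-factor hypothesis on `Δ(f_a)`, the root
going to `θ` (`minpoly_ℤ θ = f_a` and `ℤ[θ] = 𝓞 K`; Mathlib's `minpoly.equivAdjoin`). [cite: Marcus2018, Ch. 2, Exercise 27(d),(e)] -/
theorem exists_ringEquiv_adjoinRoot_of_sq (hθ : aeval θ (csPoly a) = 0) (h3 : finrank ℚ K = 3)
    (hsq : ∀ r e : ℤ, csDisc a = r ^ 2 * e → 2 < |e| → IsUnit r) :
    ∃ e : AdjoinRoot (csPoly a) ≃+* 𝓞 K, e (AdjoinRoot.root (csPoly a)) = thetaInt hθ := by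
  have htop := adjoin_thetaInt_eq_top_of_sq hθ h3 hsq
  have key : ∀ g : ℤ[X], g = minpoly ℤ (thetaInt hθ) →
      ∃ e : AdjoinRoot g ≃+* 𝓞 K, e (AdjoinRoot.root g) = thetaInt hθ := by
    intro g hg
    subst hg
    have hint : IsIntegral ℤ (thetaInt hθ) := Algebra.IsIntegral.isIntegral _
    let e₁ := minpoly.equivAdjoin hint
    let e₂ : Algebra.adjoin ℤ ({thetaInt hθ} : Set (𝓞 K)) ≃ₐ[ℤ] 𝓞 K :=
      (Subalgebra.equivOfEq _ _ htop).trans Subalgebra.topEquiv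
    refine ⟨(e₁.trans e₂).toRingEquiv, ?_⟩
    have h1 : ((e₁ (AdjoinRoot.root _) : Algebra.adjoin ℤ ({thetaInt hθ} : Set (𝓞 K))) : 𝓞 K) =
        thetaInt hθ := by
      change ((minpoly.equivAdjoin hint (AdjoinRoot.mk _ X) : Algebra.adjoin ℤ _) : 𝓞 K) = _
      rw [minpoly.coe_equivAdjoin]
      exact AdjoinRoot.Minpoly.coe_toAdjoin_mk_X
    have h2 : ∀ y, e₂ y = (y : 𝓞 K) := fun y => rfl
    calc (e₁.trans e₂).toRingEquiv (AdjoinRoot.root _) = e₂ (e₁ (AdjoinRoot.root _)) := rfl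
      _ = ((e₁ (AdjoinRoot.root _) : Algebra.adjoin ℤ ({thetaInt hθ} : Set (𝓞 K))) : 𝓞 K) := h2 _
      _ = thetaInt hθ := h1
  exact key _ (minpoly_thetaInt hθ).symm

/-- **The residue map at a degree-one prime**: if `f₋₅(c) ≡ 0 (mod q)` there is a ring
homomorphism `ψ : 𝓞 K → ℤ/q` with `ψ(θ) = c` (reduction modulo `(q, θ - c)`; it is
`ℤ[X]/(f₋₅) → ℤ/q`, `X ↦ c`, through `ℤ[X]/(f₋₅) ≅ 𝓞 K`). [cite: Marcus2018, Ch. 3, Thm. 27] -/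
theorem exists_ringHom_zmod_negFive (hθ : aeval θ (csPoly (-5)) = 0) (h3 : finrank ℚ K = 3)
    {q : ℕ} (c : ℤ)
    (hc : (c : ZMod q) ^ 3 + 5 * (c : ZMod q) ^ 2 - 6 * (c : ZMod q) - 1 = 0) :
    ∃ ψ : 𝓞 K →+* ZMod q, ψ (thetaInt hθ) = c := by
  obtain ⟨e, he⟩ := exists_ringEquiv_adjoinRoot_of_sq hθ h3 csDisc_negFive_sq
  have hev : (csPoly (-5)).eval₂ (Int.castRingHom (ZMod q)) (c : ZMod q) = 0 := by
    simp only [csPoly, eval₂_sub, eval₂_add, eval₂_mul, eval₂_X_pow, eval₂_C, eval₂_X, eval₂_one,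
      Int.coe_castRingHom]
    push_cast
    linear_combination hc
  refine ⟨(AdjoinRoot.lift (Int.castRingHom (ZMod q)) (c : ZMod q) hev).comp e.symm.toRingHom, ?_⟩
  rw [RingHom.comp_apply]
  change AdjoinRoot.lift _ _ hev (e.symm (thetaInt hθ)) = _
  rw [← he, e.symm_apply_apply, AdjoinRoot.lift_root]

/-! ### The unit rank is at most two, and units reduce to `±∏ εᵢ^{0,1}` modulo squares -/

/-- For a cubic field the unit rank `r₁ + r₂ - 1` is at most `2` (`r₁ + 2 r₂ = 3`). [folklore] -/
theorem units_rank_le_two (h3 : finrank ℚ K = 3) : NumberField.Units.rank K ≤ 2 := by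
  have h1 := NumberField.InfinitePlace.card_add_two_mul_card_eq_rank K
  have h2 := NumberField.InfinitePlace.card_eq_nrRealPlaces_add_nrComplexPlaces K
  rw [h3] at h1
  rw [NumberField.Units.rank, h2]
  omega

/-- **Units modulo squares (Dirichlet).** In a cubic field every unit is `ρ(e) η²` where
`ρ(s, ε) = (-1)^s ∏ᵢ εᵢ^{εᵢ'}` over Mathlib's fundamental system `εᵢ` (`i < rank K`), with
`s, εᵢ' ∈ {0, 1}`: write `x = ζ ∏ εᵢ^{eᵢ}` (`NumberField.Units.exist_unique_eq_mul_prod`) with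
`ζ = ±1` (odd degree, `NumberField.Units.torsion_eq_one_or_neg_one_of_odd_finrank`) and split
`eᵢ = 2⌊eᵢ/2⌋ + (eᵢ mod 2)`. [cite: Marcus2018, Ch. 5, Thm. 38] -/
theorem exists_rep_mul_sq (h3 : finrank ℚ K = 3) (x : (𝓞 K)ˣ) :
    ∃ (s : Fin 2) (ε : Fin (NumberField.Units.rank K) → Fin 2) (η : (𝓞 K)ˣ),
      x = ((-1) ^ (s : ℕ) * ∏ i, NumberField.Units.fundSystem K i ^ ((ε i : ℕ))) * η ^ 2 := by
  classical
  obtain ⟨⟨ζ, e⟩, hx, -⟩ := NumberField.Units.exist_unique_eq_mul_prod K x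
  have hodd : Odd (finrank ℚ K) := by rw [h3]; decide
  -- the exponents modulo `2`
  refine ⟨if ((ζ : (𝓞 K)ˣ) = 1) then 0 else 1, fun i => ⟨(e i % 2).toNat, by omega⟩,
    ∏ i, NumberField.Units.fundSystem K i ^ (e i / 2), ?_⟩
  have hsplit : ∀ i, NumberField.Units.fundSystem K i ^ e i =
      NumberField.Units.fundSystem K i ^ (((⟨(e i % 2).toNat, by omega⟩ : Fin 2) : ℕ)) *
        (NumberField.Units.fundSystem K i ^ (e i / 2)) ^ 2 := by
    intro i
    rw [← zpow_natCast, ← zpow_natCast (NumberField.Units.fundSystem K i ^ (e i / 2)) 2,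
      ← zpow_mul, ← zpow_add]
    congr 1
    push_cast
    rw [Int.toNat_of_nonneg (Int.emod_nonneg _ two_ne_zero)]
    omega
  rw [← Finset.prod_pow, mul_assoc, ← Finset.prod_mul_distrib]
  simp_rw [← hsplit]
  rcases NumberField.Units.torsion_eq_one_or_neg_one_of_odd_finrank hodd ζ with hζ | hζ
  · rw [if_pos hζ]
    simp only [Fin.val_zero, pow_zero, one_mul]
    rw [hζ, one_mul] at hx
    exact hx
  · have hne : (ζ : (𝓞 K)ˣ) ≠ 1 := by
      rw [hζ]
      intro h
      have h' := congrArg (fun u : (𝓞 K)ˣ => (u : 𝓞 K)) h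
      simp only [Units.val_neg, Units.val_one] at h'
      norm_num at h'
    rw [if_neg hne]
    simp only [Fin.val_one, pow_one]
    rw [hζ] at hx
    exact hx

/-! ### A unit of trivial signature is a square -/

omit [NumberField K] in
/-- Values of a ring homomorphism to `ℤ/q` on units are non-zero (`q > 1`). [folklore] -/
theorem ringHom_units_ne_zero {q : ℕ} [Fact (1 < q)] (ψ : 𝓞 K →+* ZMod q) (x : (𝓞 K)ˣ) :
    ψ (x : 𝓞 K) ≠ 0 :=
  (Units.map (ψ : 𝓞 K →* ZMod q) x).ne_zero

/-- **Units of trivial signature are squares.** Let `ψ₃, ψ₅, ψ₇ : 𝓞 K → 𝔽₃, 𝔽₅, 𝔽₇` be the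
residue maps at `(3, θ-2)`, `(5, θ-2)`, `(7, θ-4)`. If a unit `x` has `ψ₃(x) = 1`, `ψ₅(x)² = 1`,
`ψ₇(x)³ = 1` (trivial quadratic-residue signature), then `x` is the square of a unit. Proof: the
signature `σ` is a homomorphism to `{±1}³`, trivial on squares; by Dirichlet every unit is
`ρ(e) η²` for one of `≤ 2 · 2^{rank K} ≤ 8` elements `ρ(e)`; the units `±θ^i(θ-1)^j` realise all
`8` signatures, so `σ ∘ ρ` is a bijection onto `{±1}³` and `σ(x) = 1 = σ(ρ(0))` forces `ρ(e) = 1`. [cite: Marcus2018, Ch. 5, Thm. 38] -/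
theorem isSquare_of_signature_eq_one_negFive (hθ : aeval θ (csPoly (-5)) = 0)
    (h3 : finrank ℚ K = 3) (ψ₃ : 𝓞 K →+* ZMod 3) (hψ₃ : ψ₃ (thetaInt hθ) = 2)
    (ψ₅ : 𝓞 K →+* ZMod 5) (hψ₅ : ψ₅ (thetaInt hθ) = 2)
    (ψ₇ : 𝓞 K →+* ZMod 7) (hψ₇ : ψ₇ (thetaInt hθ) = 4)
    (x : (𝓞 K)ˣ) (hx₃ : ψ₃ (x : 𝓞 K) = 1) (hx₅ : ψ₅ (x : 𝓞 K) ^ 2 = 1)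
    (hx₇ : ψ₇ (x : 𝓞 K) ^ 3 = 1) :
    ∃ η : (𝓞 K)ˣ, x = η ^ 2 := by
  classical
  haveI : Fact (1 < 3) := ⟨by norm_num⟩
  haveI : Fact (1 < 5) := ⟨by norm_num⟩
  haveI : Fact (1 < 7) := ⟨by norm_num⟩
  have rel := thetaInt_rel_negFive hθ
  set t := thetaInt hθ with ht
  -- the signature
  let σ : (𝓞 K)ˣ → ZMod 3 × ZMod 5 × ZMod 7 := fun y =>
    (ψ₃ (y : 𝓞 K), ψ₅ (y : 𝓞 K) ^ 2, ψ₇ (y : 𝓞 K) ^ 3)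
  have hσmul : ∀ y z, σ (y * z) = σ y * σ z := by
    intro y z
    simp only [σ, Units.val_mul, map_mul, mul_pow, Prod.mk_mul_mk]
  have hσsq : ∀ η, σ (η ^ 2) = 1 := by
    intro η
    have h3' : ∀ u : ZMod 3, u ≠ 0 → u ^ 2 = 1 := by decide
    have h5' : ∀ u : ZMod 5, u ≠ 0 → (u ^ 2) ^ 2 = 1 := by decide
    have h7' : ∀ u : ZMod 7, u ≠ 0 → (u ^ 2) ^ 3 = 1 := by decide
    simp only [σ, Units.val_pow_eq_pow_val, map_pow]
    rw [h3' _ (ringHom_units_ne_zero ψ₃ η), h5' _ (ringHom_units_ne_zero ψ₅ η),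
      h7' _ (ringHom_units_ne_zero ψ₇ η)]
    rfl
  -- the reduction set and map
  set F := NumberField.Units.fundSystem K with hF
  let E := Fin 2 × (Fin (NumberField.Units.rank K) → Fin 2)
  let ρ : E → (𝓞 K)ˣ := fun e => (-1) ^ (e.1 : ℕ) * ∏ i, F i ^ ((e.2 i : ℕ))
  have hρ0 : ρ (0, fun _ => 0) = 1 := by
    simp [ρ]
  have hcardE : Fintype.card E ≤ 8 := by
    have hr := units_rank_le_two (K := K) h3
    simp only [E, Fintype.card_prod, Fintype.card_fun, Fintype.card_fin]
    calc 2 * 2 ^ NumberField.Units.rank K ≤ 2 * 2 ^ 2 :=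
          Nat.mul_le_mul_left 2 (Nat.pow_le_pow_right (by norm_num) hr)
      _ = 8 := by norm_num
  -- the eight signatures are realised by `±θ^i(θ-1)^j`
  let tU : (𝓞 K)ˣ := Units.mkOfMulEqOne t (t ^ 2 + 5 * t - 6) (by linear_combination rel)
  let t1U : (𝓞 K)ˣ := Units.mkOfMulEqOne (t - 1) (t ^ 2 + 6 * t) (by linear_combination rel)
  have hσt : σ tU = (2, 4, 1) := by
    simp only [σ, tU, Units.val_mkOfMulEqOne, hψ₃, hψ₅, hψ₇]
    decide
  have hσt1 : σ t1U = (1, 1, 6) := by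
    simp only [σ, t1U, Units.val_mkOfMulEqOne, map_sub, map_one, hψ₃, hψ₅, hψ₇]
    decide
  have hσn : σ (-1) = (2, 1, 6) := by
    simp only [σ, Units.val_neg, Units.val_one, map_neg, map_one]
    decide
  let T : Finset (ZMod 3 × ZMod 5 × ZMod 7) :=
    {(1, 1, 1), (1, 1, 6), (2, 4, 1), (2, 1, 6), (2, 4, 6), (1, 4, 6), (2, 1, 1), (1, 4, 1)}
  have hTcard : T.card = 8 := by decide
  -- every unit is `ρ e * η²`, so `σ y = σ (ρ e)`
  have hred : ∀ y : (𝓞 K)ˣ, ∃ e : E, σ y = σ (ρ e) := by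
    intro y
    obtain ⟨s, ε, η, hy⟩ := exists_rep_mul_sq h3 y
    refine ⟨(s, ε), ?_⟩
    rw [hy, hσmul, hσsq, mul_one]
  have hsurjT : T ⊆ Finset.univ.image (σ ∘ ρ) := by
    intro v hv
    rw [Finset.mem_image]
    -- a unit realising `v`
    have hreal : ∃ y : (𝓞 K)ˣ, σ y = v := by
      simp only [T, Finset.mem_insert, Finset.mem_singleton] at hv
      rcases hv with rfl | rfl | rfl | rfl | rfl | rfl | rfl | rfl
      · exact ⟨1, by simp only [σ, Units.val_one, map_one, one_pow]⟩
      · exact ⟨t1U, hσt1⟩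
      · exact ⟨tU, hσt⟩
      · exact ⟨-1, hσn⟩
      · exact ⟨tU * t1U, by rw [hσmul, hσt, hσt1]; decide⟩
      · exact ⟨-1 * tU, by rw [hσmul, hσn, hσt]; decide⟩
      · exact ⟨-1 * t1U, by rw [hσmul, hσn, hσt1]; decide⟩
      · exact ⟨-1 * tU * t1U, by rw [hσmul, hσmul, hσn, hσt, hσt1]; decide⟩
    obtain ⟨y, hy⟩ := hreal
    obtain ⟨e, he⟩ := hred y
    exact ⟨e, Finset.mem_univ e, by rw [Function.comp_apply, ← he, hy]⟩
  -- hence `σ ∘ ρ` is injective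
  have hinj : Set.InjOn (σ ∘ ρ) (Finset.univ : Finset E) := by
    rw [← Finset.card_image_iff]
    apply le_antisymm Finset.card_image_le
    calc (Finset.univ : Finset E).card = Fintype.card E := Finset.card_univ
      _ ≤ 8 := hcardE
      _ = T.card := hTcard.symm
      _ ≤ (Finset.univ.image (σ ∘ ρ)).card := Finset.card_le_card hsurjT
  -- conclusion
  obtain ⟨s, ε, η, hxe⟩ := exists_rep_mul_sq h3 x
  have hσx : σ x = 1 := by
    simp only [σ, hx₃, hx₅, hx₇]
    rfl
  have hρe : σ (ρ (s, ε)) = σ (ρ (0, fun _ => 0)) := by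
    rw [hρ0]
    have : σ x = σ (ρ (s, ε)) := by rw [hxe, hσmul, hσsq, mul_one]
    rw [← this, hσx]
    simp only [σ, Units.val_one, map_one, one_pow]
    rfl
  have he0 : (s, ε) = (0, fun _ => 0) :=
    hinj (Finset.mem_univ _) (Finset.mem_univ _) hρe
  refine ⟨η, ?_⟩
  rw [hxe, show ((-1) ^ (s : ℕ) * ∏ i, F i ^ ((ε i : ℕ)) : (𝓞 K)ˣ) = ρ (s, ε) from rfl, he0, hρ0,
    one_mul]

/-! ### `𝔭₅` is not principal: class number two -/

/-- **`𝔭₅ = (5, θ - 2)` is not principal** (Aitchison–Rubinstein, Table 1, row `a = -5`: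
`|C(R')| = 2`; Example `a = -5`: `[B₅]` is the non-trivial class). Proof: `𝔭₅ = (α)` gives
`α² u = 2θ + 1` for a unit `u` (`𝔭₅² = (2θ + 1)`); `u = r η²` with `r ∈ {±θ^i(θ-1)^j}` of the
same residue signature at `3, 5, 7` (`isSquare_of_signature_eq_one_negFive`), so
`(αη)² r = 2θ + 1`, refuted modulo a prime `q ∈ {3, 7, 13, 17}` where `(2c+1)/r(c)` is not a
square: `r = 1, θ-1, -θ, -θ(θ-1)` at `q = 3`; `r = -1, θ(θ-1)` at `q = 7`; `r = θ` at `q = 13`;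
`r = -(θ-1)` at `q = 17`. [cite: AitchisonRubinstein1984, Appendix, Table 1 (row a = -5) and Example a = -5] -/
theorem not_isPrincipal_P5_negFive (hθ : aeval θ (csPoly (-5)) = 0) (h3 : finrank ℚ K = 3) :
    ¬ (span {(5 : 𝓞 K), thetaInt hθ - 2}).IsPrincipal := by
  classical
  -- finite facts in `𝔽₃, 𝔽₅, 𝔽₇` (decided before any local instance is in scope)
  have h3v : ∀ z : ZMod 3, z ≠ 0 → z = 1 ∨ z = 2 := by decide
  have h5v : ∀ z : ZMod 5, z ≠ 0 → z ^ 2 = 1 ∨ z ^ 2 = 4 := by decide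
  have h7v : ∀ z : ZMod 7, z ≠ 0 → z ^ 3 = 1 ∨ z ^ 3 = 6 := by decide
  have c3 : ∀ w b : ZMod 3, b ≠ 0 → w * b = b → w = 1 := by decide
  have c5 : ∀ w b : ZMod 5, b ≠ 0 → w ^ 2 * b ^ 2 = b ^ 2 → w ^ 2 = 1 := by decide
  have c7 : ∀ w b : ZMod 7, b ≠ 0 → w ^ 3 * b ^ 3 = b ^ 3 → w ^ 3 = 1 := by decide
  haveI : Fact (1 < 3) := ⟨by norm_num⟩
  haveI : Fact (1 < 5) := ⟨by norm_num⟩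
  haveI : Fact (1 < 7) := ⟨by norm_num⟩
  haveI : Fact (1 < 13) := ⟨by norm_num⟩
  haveI : Fact (1 < 17) := ⟨by norm_num⟩
  intro hprinc
  have rel := thetaInt_rel_negFive hθ
  -- residue maps
  obtain ⟨ψ₃, hψ₃⟩ := exists_ringHom_zmod_negFive hθ h3 (q := 3) 2 (by decide)
  obtain ⟨ψ₅, hψ₅⟩ := exists_ringHom_zmod_negFive hθ h3 (q := 5) 2 (by decide)
  obtain ⟨ψ₇, hψ₇⟩ := exists_ringHom_zmod_negFive hθ h3 (q := 7) 4 (by decide)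
  obtain ⟨ψ₁₃, hψ₁₃⟩ := exists_ringHom_zmod_negFive hθ h3 (q := 13) 9 (by decide)
  obtain ⟨ψ₁₇, hψ₁₇⟩ := exists_ringHom_zmod_negFive hθ h3 (q := 17) 4 (by decide)
  set t := thetaInt hθ with ht
  push_cast at hψ₃ hψ₅ hψ₇ hψ₁₃ hψ₁₇
  -- `𝔭₅ = (α)`, `α² u = 2θ + 1`
  obtain ⟨α, hα⟩ := hprinc.principal
  have hα' : span {(5 : 𝓞 K), t - 2} = span {α} := by rw [hα, Ideal.submodule_span_eq]
  have hsq : span {α ^ 2} = span {2 * t + 1} := by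
    rw [pow_two, ← Ideal.span_singleton_mul_span_singleton, ← hα']
    exact P5_mul_P5_negFive hθ
  obtain ⟨u, hu⟩ := Ideal.span_singleton_eq_span_singleton.mp hsq
  -- the units `θ`, `θ - 1`
  let tU : (𝓞 K)ˣ := Units.mkOfMulEqOne t (t ^ 2 + 5 * t - 6) (by linear_combination rel)
  let t1U : (𝓞 K)ˣ := Units.mkOfMulEqOne (t - 1) (t ^ 2 + 6 * t) (by linear_combination rel)
  -- the signature of `u`
  -- the key step: for a representative `r` with `σ(u r⁻¹) = 1`, `(α η)² r = 2θ + 1`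
  have key : ∀ r : (𝓞 K)ˣ, ψ₃ ((u * r⁻¹ : (𝓞 K)ˣ) : 𝓞 K) = 1 →
      ψ₅ ((u * r⁻¹ : (𝓞 K)ˣ) : 𝓞 K) ^ 2 = 1 → ψ₇ ((u * r⁻¹ : (𝓞 K)ˣ) : 𝓞 K) ^ 3 = 1 →
      ∃ β : 𝓞 K, β ^ 2 * (r : 𝓞 K) = 2 * t + 1 := by
    intro r h₃ h₅ h₇
    obtain ⟨η, hη⟩ := isSquare_of_signature_eq_one_negFive hθ h3 ψ₃ hψ₃ ψ₅ hψ₅ ψ₇ hψ₇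
      (u * r⁻¹) h₃ h₅ h₇
    refine ⟨α * (η : 𝓞 K), ?_⟩
    have hur : (u : 𝓞 K) = (r : 𝓞 K) * ((η : 𝓞 K)) ^ 2 := by
      have := congrArg (fun w : (𝓞 K)ˣ => ((w * r : (𝓞 K)ˣ) : 𝓞 K)) hη
      simp only [inv_mul_cancel_right, Units.val_mul, Units.val_pow_eq_pow_val] at this
      rw [this]
      ring
    rw [← hu, hur]
    ring
  -- residues of `u r⁻¹`: `ψ (u r⁻¹) = ψ u / ψ r`; we case on the signature of `u`
  have hinv : ∀ {q : ℕ} (ψ : 𝓞 K →+* ZMod q) (r : (𝓞 K)ˣ),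
      ψ ((u * r⁻¹ : (𝓞 K)ˣ) : 𝓞 K) * ψ (r : 𝓞 K) = ψ (u : 𝓞 K) := by
    intro q ψ r
    rw [← map_mul, Units.val_mul, mul_assoc, ← Units.val_mul, inv_mul_cancel, Units.val_one,
      mul_one]
  -- refutation modulo `q`: `β² r(c) = 2c + 1` is impossible
  have refute : ∀ {q : ℕ} (ψ : 𝓞 K →+* ZMod q) (c : ZMod q) (hψ : ψ t = c) (r : (𝓞 K)ˣ)
      (rc : ZMod q), ψ (r : 𝓞 K) = rc → (∀ z : ZMod q, z ^ 2 * rc ≠ 2 * c + 1) →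
      (∃ β : 𝓞 K, β ^ 2 * (r : 𝓞 K) = 2 * t + 1) → False := by
    intro q ψ c hψ r rc hrc hz ⟨β, hβ⟩
    have := congrArg ψ hβ
    rw [map_mul, map_pow, hrc, map_add, map_mul, map_one, hψ] at this
    exact hz (ψ β) (by rw [this, map_ofNat])
  -- values of the residue maps on `θ`, `θ - 1`, `-1`
  have hu3 := h3v _ ((Units.map (ψ₃ : 𝓞 K →* ZMod 3) u).ne_zero)
  have hu5 := h5v _ ((Units.map (ψ₅ : 𝓞 K →* ZMod 5) u).ne_zero)
  have hu7 := h7v _ ((Units.map (ψ₇ : 𝓞 K →* ZMod 7) u).ne_zero)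
  simp only [Units.coe_map, MonoidHom.coe_coe] at hu3 hu5 hu7
  -- helper producing the three signature equations for `u r⁻¹` from those of `u` and `r`
  have sig : ∀ (r : (𝓞 K)ˣ) (a₃ : ZMod 3) (a₅ : ZMod 5) (a₇ : ZMod 7),
      ψ₃ (r : 𝓞 K) = a₃ → ψ₅ (r : 𝓞 K) = a₅ → ψ₇ (r : 𝓞 K) = a₇ →
      ψ₃ (u : 𝓞 K) = a₃ → ψ₅ (u : 𝓞 K) ^ 2 = a₅ ^ 2 → ψ₇ (u : 𝓞 K) ^ 3 = a₇ ^ 3 →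
      a₃ ≠ 0 → a₅ ≠ 0 → a₇ ≠ 0 →
      ψ₃ ((u * r⁻¹ : (𝓞 K)ˣ) : 𝓞 K) = 1 ∧ ψ₅ ((u * r⁻¹ : (𝓞 K)ˣ) : 𝓞 K) ^ 2 = 1 ∧
        ψ₇ ((u * r⁻¹ : (𝓞 K)ˣ) : 𝓞 K) ^ 3 = 1 := by
    intro r a₃ a₅ a₇ hr₃ hr₅ hr₇ e₃ e₅ e₇ n₃ n₅ n₇
    have k₃ := hinv ψ₃ r
    have k₅ := hinv ψ₅ r
    have k₇ := hinv ψ₇ r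
    rw [hr₃, e₃] at k₃
    rw [hr₅] at k₅
    rw [hr₇] at k₇
    refine ⟨c3 _ _ n₃ k₃, c5 _ _ n₅ ?_, c7 _ _ n₇ ?_⟩
    · have h := congrArg (· ^ 2) k₅
      simp only [mul_pow] at h
      rw [e₅] at h
      exact h
    · have h := congrArg (· ^ 3) k₇
      simp only [mul_pow] at h
      rw [e₇] at h
      exact h
  -- residues of the generators
  have t3 : ψ₃ (tU : 𝓞 K) = 2 := by simp only [tU, Units.val_mkOfMulEqOne, hψ₃]
  have t5 : ψ₅ (tU : 𝓞 K) = 2 := by simp only [tU, Units.val_mkOfMulEqOne, hψ₅]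
  have t7 : ψ₇ (tU : 𝓞 K) = 4 := by simp only [tU, Units.val_mkOfMulEqOne, hψ₇]
  have t13 : ψ₁₃ (tU : 𝓞 K) = 9 := by simp only [tU, Units.val_mkOfMulEqOne, hψ₁₃]
  have s3 : ψ₃ (t1U : 𝓞 K) = 1 := by
    simp only [t1U, Units.val_mkOfMulEqOne, map_sub, map_one, hψ₃]; decide
  have s5 : ψ₅ (t1U : 𝓞 K) = 1 := by
    simp only [t1U, Units.val_mkOfMulEqOne, map_sub, map_one, hψ₅]; decide
  have s7 : ψ₇ (t1U : 𝓞 K) = 3 := by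
    simp only [t1U, Units.val_mkOfMulEqOne, map_sub, map_one, hψ₇]; decide
  have s17 : ψ₁₇ (t1U : 𝓞 K) = 3 := by
    simp only [t1U, Units.val_mkOfMulEqOne, map_sub, map_one, hψ₁₇]; decide
  have n3 : ψ₃ ((-1 : (𝓞 K)ˣ) : 𝓞 K) = -1 := by simp only [Units.val_neg, Units.val_one, map_neg, map_one]
  have n5 : ψ₅ ((-1 : (𝓞 K)ˣ) : 𝓞 K) = -1 := by simp only [Units.val_neg, Units.val_one, map_neg, map_one]
  have n7 : ψ₇ ((-1 : (𝓞 K)ˣ) : 𝓞 K) = -1 := by simp only [Units.val_neg, Units.val_one, map_neg, map_one]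
  have n17 : ψ₁₇ ((-1 : (𝓞 K)ˣ) : 𝓞 K) = -1 := by simp only [Units.val_neg, Units.val_one, map_neg, map_one]
  -- the eight cases
  rcases hu3 with e₃ | e₃ <;> rcases hu5 with e₅ | e₅ <;> rcases hu7 with e₇ | e₇
  · -- `(+,+,+)`: `r = 1`, refute mod `3`: `z² ≠ 5 = 2`
    obtain ⟨k1, k2, k3⟩ := sig 1 1 1 1 (by simp) (by simp) (by simp) e₃ (by rw [e₅]; decide)
      (by rw [e₇]; decide) one_ne_zero one_ne_zero one_ne_zero
    exact refute ψ₃ 2 hψ₃ 1 1 (by simp) (by decide) (key 1 k1 k2 k3)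
  · -- `(+,+,-)`: `r = θ - 1`, refute mod `3` (`r(2) = 1`)
    obtain ⟨k1, k2, k3⟩ := sig t1U 1 1 3 s3 s5 s7 e₃ (by rw [e₅]; decide) (by rw [e₇]; decide)
      one_ne_zero one_ne_zero (by decide)
    exact refute ψ₃ 2 hψ₃ t1U 1 s3 (by decide) (key t1U k1 k2 k3)
  · -- `(+,-,+)`: `r = -θ(θ-1)`, refute mod `3` (`r(2) = -2·1 = 1`)
    obtain ⟨k1, k2, k3⟩ := sig (-1 * tU * t1U) 1 3 2
      (by rw [Units.val_mul, Units.val_mul, map_mul, map_mul, n3, t3, s3]; decide)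
      (by rw [Units.val_mul, Units.val_mul, map_mul, map_mul, n5, t5, s5]; decide)
      (by rw [Units.val_mul, Units.val_mul, map_mul, map_mul, n7, t7, s7]; decide)
      e₃ (by rw [e₅]; decide) (by rw [e₇]; decide) one_ne_zero (by decide) (by decide)
    exact refute ψ₃ 2 hψ₃ (-1 * tU * t1U) 1
      (by rw [Units.val_mul, Units.val_mul, map_mul, map_mul, n3, t3, s3]; decide) (by decide)
      (key _ k1 k2 k3)
  · -- `(+,-,-)`: `r = -θ`, refute mod `3` (`r(2) = -2 = 1`)
    obtain ⟨k1, k2, k3⟩ := sig (-1 * tU) 1 3 3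
      (by rw [Units.val_mul, map_mul, n3, t3]; decide) (by rw [Units.val_mul, map_mul, n5, t5]; decide)
      (by rw [Units.val_mul, map_mul, n7, t7]; decide)
      e₃ (by rw [e₅]; decide) (by rw [e₇]; decide) one_ne_zero (by decide) (by decide)
    exact refute ψ₃ 2 hψ₃ (-1 * tU) 1 (by rw [Units.val_mul, map_mul, n3, t3]; decide) (by decide)
      (key _ k1 k2 k3)
  · -- `(-,+,+)`: `r = -(θ-1)`, refute mod `17` (`θ ↦ 4`, `r(4) = -3 = 14`, `2c+1 = 9`)
    obtain ⟨k1, k2, k3⟩ := sig (-1 * t1U) 2 4 4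
      (by rw [Units.val_mul, map_mul, n3, s3]; decide) (by rw [Units.val_mul, map_mul, n5, s5]; decide)
      (by rw [Units.val_mul, map_mul, n7, s7]; decide)
      e₃ (by rw [e₅]; decide) (by rw [e₇]; decide) (by decide) (by decide) (by decide)
    exact refute ψ₁₇ 4 hψ₁₇ (-1 * t1U) 14 (by rw [Units.val_mul, map_mul, n17, s17]; decide)
      (by decide) (key _ k1 k2 k3)
  · -- `(-,+,-)`: `r = -1`, refute mod `7` (`2c+1 = 9 = 2`, `r = -1`: `z² ≠ -2`)
    obtain ⟨k1, k2, k3⟩ := sig (-1) 2 4 6 (by rw [n3]; decide) (by rw [n5]; decide)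
      (by rw [n7]; decide) e₃ (by rw [e₅]; decide) (by rw [e₇]; decide) (by decide) (by decide)
      (by decide)
    exact refute ψ₇ 4 hψ₇ (-1) 6 (by rw [n7]; decide) (by decide) (key _ k1 k2 k3)
  · -- `(-,-,+)`: `r = θ`, refute mod `13` (`θ ↦ 9`, `2c+1 = 19 = 6`)
    obtain ⟨k1, k2, k3⟩ := sig tU 2 2 4 t3 t5 t7 e₃ (by rw [e₅]; decide) (by rw [e₇]; decide)
      (by decide) (by decide) (by decide)
    exact refute ψ₁₃ 9 hψ₁₃ tU 9 t13 (by decide) (key _ k1 k2 k3)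
  · -- `(-,-,-)`: `r = θ(θ-1)`, refute mod `7` (`r(4) = 12 = 5`, `2c+1 = 2`)
    obtain ⟨k1, k2, k3⟩ := sig (tU * t1U) 2 2 5
      (by rw [Units.val_mul, map_mul, t3, s3]; decide) (by rw [Units.val_mul, map_mul, t5, s5]; decide)
      (by rw [Units.val_mul, map_mul, t7, s7]; decide)
      e₃ (by rw [e₅]; decide) (by rw [e₇]; decide) (by decide) (by decide) (by decide)
    exact refute ψ₇ 4 hψ₇ (tU * t1U) 5 (by rw [Units.val_mul, map_mul, t7, s7]; decide)
      (by decide) (key _ k1 k2 k3)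

/-- **The class of `𝔭₅` is not trivial.** [cite: AitchisonRubinstein1984, Appendix, Example a = -5] -/
theorem mk0_P5_ne_one_negFive (hθ : aeval θ (csPoly (-5)) = 0) (h3 : finrank ℚ K = 3) :
    ClassGroup.mk0 ⟨span {(5 : 𝓞 K), thetaInt hθ - 2}, P5_mem_nonZeroDivisors_negFive hθ⟩ ≠ 1 :=
  fun h => not_isPrincipal_P5_negFive hθ h3 ((ClassGroup.mk0_eq_one_iff _).mp h)

/-- **Class number two (proved): Aitchison–Rubinstein 1984, Table 1, row `a = -5`** (`Δ = 2777`,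
prime, `R = R'`, `|C(R')| = 2`): the class group of a cubic field generated by a root of
`f₋₅ = x³ + 5x² - 6x - 1` has exactly two elements, `1` and `[𝔭₅]`. [cite: AitchisonRubinstein1984, Appendix, Table 1 (row a = -5)] -/
theorem classNumber_eq_two_negFive (hθ : aeval θ (csPoly (-5)) = 0) (h3 : finrank ℚ K = 3) :
    NumberField.classNumber K = 2 := by
  classical
  set c5 : ClassGroup (𝓞 K) :=
    ClassGroup.mk0 ⟨span {(5 : 𝓞 K), thetaInt hθ - 2}, P5_mem_nonZeroDivisors_negFive hθ⟩ with hc5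
  have hne : (1 : ClassGroup (𝓞 K)) ≠ c5 := fun h => mk0_P5_ne_one_negFive hθ h3 h.symm
  have huniv : (Finset.univ : Finset (ClassGroup (𝓞 K))) = {1, c5} := by
    ext C
    simp only [Finset.mem_univ, Finset.mem_insert, Finset.mem_singleton, true_iff]
    exact classGroup_mem_pair_negFive hθ h3 C
  unfold NumberField.classNumber
  rw [← Finset.card_univ, huniv, Finset.card_pair hne]

end Root

end Literature.Topology.FourManifolds

end
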